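import Literature.Topology.PlanarFoliations.Reverse
import Literature.Topology.PlanarFoliations.LeafLoop
import Mathlib.Order.Zorn
import HarnessLib

/-!
# Kneser's theorem for planar foliations: a compact leaf encloses a puncture

Topic: Topology / PlanarFoliations, sequel to `OmegaLimit.lean`, `Reverse.lean`. Let `F` be a
bi-oriented foliation of a plane domain `X ↪ ℂ` (open embedding `ι`) and `K` a compact leaf:
a Jordan curve `ι(K)` (`exists_leafLoop_of_isCompact`, `JordanCurveTheorem_holds`), with
inner domain `insideLeaf` and closed disc `discLeaf = ι(K) ∪ insideLeaf`. **The closed disc is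
not contained in the domain `ι(X)`** (`not_discLeaf_subset_range`): a foliation of a closed disc
tangent to the boundary has a singularity (H. Kneser, *Reguläre Kurvenscharen auf den
Ringflächen*, Math. Ann. 91 (1924); e.g. Hector–Hirsch, *Introduction to the Geometry of
Foliations, Part A*, Ch. IV; Camacho–Lins Neto, Ch. VI §4, where it enters through the index
theorem: "a closed orbit bounds a disc containing a singularity").

Proof (Poincaré–Bendixson and Zorn's lemma). If `discLeaf K ⊆ ι(X)`, the discs of the compact
leaves inside `discLeaf K` form a family closed under nested intersections up to shrinking
(`exists_disc_subset_sInter`): a nested intersection `D₀` is compact, saturated and in the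
domain, so a leaf `L ⊆ D₀` is compact, or its ω-limit set (nonempty, in `D₀`) contains a point
of the domain whose leaf is compact by `not_mem_omegaSet_of_mem_omegaSet`. Zorn's lemma gives a
minimal disc `D = discLeaf K₀`; a point inside lies on a leaf `L ⊆ D`, compact (a smaller disc)
or open with ω- and α-limit compact leaves in `D`, smaller discs unless both are `K₀` itself —
and **an open leaf inside `K₀` cannot both ω- and α-accumulate on `K₀`**
(`not_mem_omegaSet_and_alphaSet`): its crossings with the vertical through a point of `K₀` lie on
one side of it (`F1`, `compactLeaf_vert_subsingleton`), and three of them, `r < p < q` with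
`ht p < ht q < ht r < s` (ω-accumulation after `p`, α-accumulation before `p`), violate the
monotonicity of crossings `ht_not_mem_Ioo`.

* `insideLeaf`, `outsideLeaf`, `discLeaf` (**definitions**) and their Jordan-curve properties
  (`insideLeaf_spec`, …, **proved**); `discLeaf_subset_insideLeaf_of_subset` (nesting),
  `image_leaf_subset_discLeaf` (saturation) (**proved**).
* `omegaSet_nonempty_of_subset`, `omegaSet_subset_of_isClosed` (+ α) (**proved**).
* `ht_not_mem_Ioo_left` (**proved**): monotonicity of crossings read backwards (the flip).
* `crossings_one_side`, `not_mem_omegaSet_and_alphaSet` (**proved**).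
* `not_discLeaf_subset_range` (**proved**): Kneser's theorem.

All statements are [folklore].
-/

noncomputable section

open Set Filter Function Bornology
open _root_.Topology
open Literature.Topology.FourManifolds Literature.Topology.FourManifolds.Foliation
  Literature.Topology.FourManifolds.OneManifold Literature.Topology.PlaneTopology

namespace Literature.Topology.PlanarFoliations

variable {X : Type*} [TopologicalSpace X] [T2Space X] [SecondCountableTopology X] {F : Foliation ℝ X} {x : X}
variable {hbi : IsBiOriented F} {e : OpenPartialHomeomorph X (ℝ × ℝ)} {u₀ : ℝ} {ι : X → ℂ}

/-! ## The Jordan disc of a compact leaf -/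

variable (F ι) in
/-- **The inner domain of a compact leaf**: the points off `ι(K)` whose complementary component is
bounded. [folklore] -/
def insideLeaf (y : X) : Set ℂ :=
  {z | z ∉ ι '' F.leaf y ∧ IsBounded (connectedComponentIn (ι '' F.leaf y)ᶜ z)}

variable (F ι) in
/-- **The outer domain of a compact leaf**: the points off `ι(K)` whose complementary component is
unbounded. [folklore] -/
def outsideLeaf (y : X) : Set ℂ :=
  {z | z ∉ ι '' F.leaf y ∧ ¬ IsBounded (connectedComponentIn (ι '' F.leaf y)ᶜ z)}

variable (F ι) in
/-- **The closed Jordan disc of a compact leaf**: the leaf and its inner domain. [folklore] -/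
def discLeaf (y : X) : Set ℂ := ι '' F.leaf y ∪ insideLeaf F ι y

omit [T2Space X] [SecondCountableTopology X] in
/-- The image of a leaf is the range of the leaf map into the plane. [folklore] -/
theorem image_leaf_eq_range (y : X) : ι '' F.leaf y = range fun q : F.Leaf y ↦ ι (Leaf.pt q) := by
  ext z
  constructor
  · rintro ⟨w, hw, rfl⟩
    exact ⟨⟨toLeafSpace w, hw⟩, rfl⟩
  · rintro ⟨q, rfl⟩
    exact ⟨Leaf.pt q, q.2, rfl⟩

omit [T2Space X] [SecondCountableTopology X] in
/-- The image of a leaf in the plane is connected. [folklore] -/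
theorem isConnected_image_leaf (hιc : Continuous ι) (y : X) : IsConnected (ι '' F.leaf y) := by
  rw [image_leaf_eq_range]
  exact isConnected_range (hιc.comp (Leaf.continuous_coe F y))

/-- **The Jordan curve theorem for a compact leaf**: the inner and outer domains are open,
connected, disjoint, they and the leaf partition the plane, both have the leaf as frontier, the
inner one is bounded and the outer one is not. [folklore] -/
theorem insideLeaf_spec (hbi : IsBiOriented F) (hι : IsOpenEmbedding ι) {y : X} (hK : IsCompact (F.leaf y)) :
    IsOpen (insideLeaf F ι y) ∧ IsOpen (outsideLeaf F ι y) ∧ IsConnected (insideLeaf F ι y) ∧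
      IsConnected (outsideLeaf F ι y) ∧ frontier (insideLeaf F ι y) = ι '' F.leaf y ∧
      frontier (outsideLeaf F ι y) = ι '' F.leaf y ∧ IsBounded (insideLeaf F ι y) ∧
      ¬ IsBounded (outsideLeaf F ι y) := by
  obtain ⟨γ, hc, hp, hinj, hsurj⟩ := exists_leafLoop_of_isCompact (x := y) hbi hK
  set g : ℝ → ℂ := fun s ↦ ι (Leaf.pt (γ s)) with hg
  have hgc : Continuous g := hι.continuous.comp ((Leaf.continuous_coe F y).comp hc)
  have hgp : Periodic g 1 := fun s ↦ by show ι (Leaf.pt (γ (s + 1))) = _; rw [hp s]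
  have hginj : InjOn g (Ico 0 1) := fun s hs t ht hst ↦
    hinj hs ht (Leaf.injective_coe F y (hι.injective hst))
  have hrange : range g = ι '' F.leaf y := by
    rw [image_leaf_eq_range, hg]
    ext z
    constructor
    · rintro ⟨s, rfl⟩; exact ⟨γ s, rfl⟩
    · rintro ⟨q, rfl⟩
      obtain ⟨s, rfl⟩ : q ∈ range γ := by rw [hsurj]; exact mem_univ q
      exact ⟨s, rfl⟩
  obtain ⟨U, V, hUo, hVo, hUc, hVc, hUV, hcover, hfU, hfV, hUb, hVb⟩ :=
    JordanCurveTheorem_holds.of_periodic hgc hgp hginj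
  rw [hrange] at hcover hfU hfV
  set C := ι '' F.leaf y with hC
  -- components of points of `U` and `V`
  have hcompU : ∀ z ∈ U, connectedComponentIn Cᶜ z = U := fun z hz ↦ by
    apply Subset.antisymm
    · refine (isPreconnected_connectedComponentIn).subset_left_of_subset_union hUo hVo hUV ?_ ⟨z, mem_connectedComponentIn (hcover ▸ Or.inl hz :  z ∈ Cᶜ), hz⟩
      rw [hcover]; exact connectedComponentIn_subset _ _
    · exact hUc.2.subset_connectedComponentIn hz (hcover ▸ subset_union_left)
  have hcompV : ∀ z ∈ V, connectedComponentIn Cᶜ z = V := fun z hz ↦ by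
    apply Subset.antisymm
    · refine (isPreconnected_connectedComponentIn).subset_right_of_subset_union hUo hVo hUV ?_ ⟨z, mem_connectedComponentIn (hcover ▸ Or.inr hz : z ∈ Cᶜ), hz⟩
      rw [hcover]; exact connectedComponentIn_subset _ _
    · exact hVc.2.subset_connectedComponentIn hz (hcover ▸ subset_union_right)
  have hin : insideLeaf F ι y = U := by
    ext z
    constructor
    · rintro ⟨hzC, hzb⟩
      rcases (hcover.symm ▸ hzC : z ∈ U ∪ V) with hz | hz
      · exact hz
      · exact absurd (hcompV z hz ▸ hzb) hVb
    · intro hz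
      exact ⟨(hcover ▸ Or.inl hz : z ∈ Cᶜ), hcompU z hz ▸ hUb⟩
  have hout : outsideLeaf F ι y = V := by
    ext z
    constructor
    · rintro ⟨hzC, hzb⟩
      rcases (hcover.symm ▸ hzC : z ∈ U ∪ V) with hz | hz
      · exact absurd (hcompU z hz ▸ hUb) hzb
      · exact hz
    · intro hz
      exact ⟨(hcover ▸ Or.inr hz : z ∈ Cᶜ), hcompV z hz ▸ hVb⟩
  rw [hin, hout]
  exact ⟨hUo, hVo, hUc, hVc, hfU, hfV, hUb, hVb⟩

omit [T2Space X] [SecondCountableTopology X] in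
/-- The plane is the disjoint union of the leaf, the inner and the outer domain. [folklore] -/
theorem mem_insideLeaf_or_mem_outsideLeaf {y : X} {z : ℂ} (hz : z ∉ ι '' F.leaf y) :
    z ∈ insideLeaf F ι y ∨ z ∈ outsideLeaf F ι y := by
  by_cases h : IsBounded (connectedComponentIn (ι '' F.leaf y)ᶜ z)
  · exact Or.inl ⟨hz, h⟩
  · exact Or.inr ⟨hz, h⟩

omit [T2Space X] [SecondCountableTopology X] in
/-- The inner and outer domains are disjoint. [folklore] -/
theorem disjoint_insideLeaf_outsideLeaf (y : X) : Disjoint (insideLeaf F ι y) (outsideLeaf F ι y) :=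
  disjoint_left.2 fun _ h₁ h₂ ↦ h₂.2 h₁.2

omit [T2Space X] [SecondCountableTopology X] in
/-- The inner domain misses the leaf. [folklore] -/
theorem not_mem_image_of_mem_insideLeaf {y : X} {z : ℂ} (hz : z ∈ insideLeaf F ι y) : z ∉ ι '' F.leaf y := hz.1

omit [T2Space X] [SecondCountableTopology X] in
/-- The outer domain misses the leaf. [folklore] -/
theorem not_mem_image_of_mem_outsideLeaf {y : X} {z : ℂ} (hz : z ∈ outsideLeaf F ι y) : z ∉ ι '' F.leaf y := hz.1

omit [T2Space X] [SecondCountableTopology X] in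
/-- The complement of the disc is the outer domain. [folklore] -/
theorem compl_discLeaf (y : X) : (discLeaf F ι y)ᶜ = outsideLeaf F ι y := by
  ext z
  simp only [discLeaf, mem_compl_iff, mem_union, not_or]
  constructor
  · rintro ⟨h₁, h₂⟩
    rcases mem_insideLeaf_or_mem_outsideLeaf h₁ with h | h
    · exact absurd h h₂
    · exact h
  · exact fun h ↦ ⟨h.1, fun h' ↦ disjoint_left.1 (disjoint_insideLeaf_outsideLeaf y) h' h⟩

/-- **A preconnected set off the leaf meeting the inner domain lies in it.** [folklore] -/
theorem subset_insideLeaf_of_isPreconnected (hbi : IsBiOriented F) (hι : IsOpenEmbedding ι) {y : X}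
    (hK : IsCompact (F.leaf y)) {S : Set ℂ} (hS : IsPreconnected S) (hSC : Disjoint S (ι '' F.leaf y))
    (hSi : (S ∩ insideLeaf F ι y).Nonempty) : S ⊆ insideLeaf F ι y := by
  obtain ⟨hUo, hVo, -⟩ := insideLeaf_spec hbi hι hK
  exact hS.subset_left_of_subset_union hUo hVo (disjoint_insideLeaf_outsideLeaf y)
    (fun z hz ↦ mem_insideLeaf_or_mem_outsideLeaf (disjoint_left.1 hSC hz)) hSi

/-- **A preconnected set off the leaf meeting the outer domain lies in it.** [folklore] -/
theorem subset_outsideLeaf_of_isPreconnected (hbi : IsBiOriented F) (hι : IsOpenEmbedding ι) {y : X}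
    (hK : IsCompact (F.leaf y)) {S : Set ℂ} (hS : IsPreconnected S) (hSC : Disjoint S (ι '' F.leaf y))
    (hSo : (S ∩ outsideLeaf F ι y).Nonempty) : S ⊆ outsideLeaf F ι y := by
  obtain ⟨hUo, hVo, -⟩ := insideLeaf_spec hbi hι hK
  exact hS.subset_right_of_subset_union hUo hVo (disjoint_insideLeaf_outsideLeaf y)
    (fun z hz ↦ mem_insideLeaf_or_mem_outsideLeaf (disjoint_left.1 hSC hz)) hSo

/-- The disc is the closure of the inner domain. [folklore] -/
theorem closure_insideLeaf (hbi : IsBiOriented F) (hι : IsOpenEmbedding ι) {y : X} (hK : IsCompact (F.leaf y)) :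
    closure (insideLeaf F ι y) = discLeaf F ι y := by
  obtain ⟨hUo, -, -, -, hfU, -⟩ := insideLeaf_spec hbi hι hK
  rw [closure_eq_self_union_frontier, hfU, discLeaf, union_comm]

/-- **The disc of a compact leaf is compact.** [folklore] -/
theorem isCompact_discLeaf (hbi : IsBiOriented F) (hι : IsOpenEmbedding ι) {y : X} (hK : IsCompact (F.leaf y)) :
    IsCompact (discLeaf F ι y) := by
  obtain ⟨-, -, -, -, -, -, hUb, -⟩ := insideLeaf_spec hbi hι hK
  rw [← closure_insideLeaf hbi hι hK]
  exact Metric.isCompact_of_isClosed_isBounded isClosed_closure hUb.closure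

/-- The disc of a compact leaf is closed. [folklore] -/
theorem isClosed_discLeaf (hbi : IsBiOriented F) (hι : IsOpenEmbedding ι) {y : X} (hK : IsCompact (F.leaf y)) :
    IsClosed (discLeaf F ι y) :=
  (isCompact_discLeaf hbi hι hK).isClosed

/-- The inner domain is nonempty. [folklore] -/
theorem insideLeaf_nonempty (hbi : IsBiOriented F) (hι : IsOpenEmbedding ι) {y : X} (hK : IsCompact (F.leaf y)) :
    (insideLeaf F ι y).Nonempty :=
  (insideLeaf_spec hbi hι hK).2.2.1.1

/-- The base point of the leaf is on the boundary of the outer domain. [folklore] -/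
theorem image_mem_closure_outsideLeaf (hbi : IsBiOriented F) (hι : IsOpenEmbedding ι) {y : X}
    (hK : IsCompact (F.leaf y)) {w : X} (hw : w ∈ F.leaf y) : ι w ∈ closure (outsideLeaf F ι y) := by
  obtain ⟨-, -, -, -, -, hfV, -⟩ := insideLeaf_spec hbi hι hK
  exact frontier_subset_closure (hfV.symm ▸ mem_image_of_mem ι hw)

omit [T2Space X] [SecondCountableTopology X] in
/-- The image of the base point lies in the disc. [folklore] -/
theorem image_mem_discLeaf {y w : X} (hw : w ∈ F.leaf y) : ι w ∈ discLeaf F ι y := Or.inl (mem_image_of_mem ι hw)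

/-! ## Nesting and saturation -/

/-- **Saturation**: a leaf meeting the disc of a compact leaf lies in it (it is the boundary leaf,
or a connected set off it meeting the inner domain). [folklore] -/
theorem image_leaf_subset_discLeaf (hbi : IsBiOriented F) (hι : IsOpenEmbedding ι) {y : X} (hK : IsCompact (F.leaf y))
    {w : X} (hw : ι w ∈ discLeaf F ι y) : ι '' F.leaf w ⊆ discLeaf F ι y := by
  by_cases hwy : w ∈ F.leaf y
  · rw [leaf_eq_of_mem hwy]
    exact subset_union_left
  · have hdisj : Disjoint (ι '' F.leaf w) (ι '' F.leaf y) := by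
      rw [disjoint_iff_inter_eq_empty, ← image_inter hι.injective, image_eq_empty]
      exact eq_empty_of_forall_notMem fun v ⟨hvw, hvy⟩ ↦ hwy (by rw [← leaf_eq_of_mem hvy, leaf_eq_of_mem hvw]; exact F.mem_leaf_self _)
    have hwin : ι w ∈ insideLeaf F ι y := by
      rcases hw with hw | hw
      · exact absurd ((hι.injective.mem_set_image).1 hw) hwy
      · exact hw
    exact (subset_insideLeaf_of_isPreconnected hbi hι hK (isConnected_image_leaf hι.continuous w).isPreconnected hdisj
      ⟨ι w, mem_image_of_mem ι (F.mem_leaf_self w), hwin⟩).trans subset_union_right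

/-- **Nesting**: the disc of a compact leaf other than `K` meeting the disc of `K` lies in the
inner domain of `K` (the closure of the outer domain of `K` is connected, unbounded and off the
smaller leaf, hence in its outer domain). [folklore] -/
theorem discLeaf_subset_insideLeaf (hbi : IsBiOriented F) (hι : IsOpenEmbedding ι) {y w : X} (hK : IsCompact (F.leaf y))
    (hKw : IsCompact (F.leaf w)) (hw : ι w ∈ discLeaf F ι y) (hwy : w ∉ F.leaf y) :
    discLeaf F ι w ⊆ insideLeaf F ι y := by
  have hLw : ι '' F.leaf w ⊆ discLeaf F ι y := image_leaf_subset_discLeaf hbi hι hK hw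
  have hdisj : Disjoint (ι '' F.leaf w) (ι '' F.leaf y) := by
    rw [disjoint_iff_inter_eq_empty, ← image_inter hι.injective, image_eq_empty]
    exact eq_empty_of_forall_notMem fun v ⟨hvw, hvy⟩ ↦ hwy (by rw [← leaf_eq_of_mem hvy, leaf_eq_of_mem hvw]; exact F.mem_leaf_self _)
  have hCw : ι '' F.leaf w ⊆ insideLeaf F ι y := fun z hz ↦ by
    rcases hLw hz with h | h
    · exact absurd h (disjoint_left.1 hdisj hz)
    · exact h
  obtain ⟨-, -, -, hVc, -, hfV, -, hVunb⟩ := insideLeaf_spec hbi hι hK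
  obtain ⟨hUo', hVo', -, -, -, -, hUb', -⟩ := insideLeaf_spec hbi hι hKw
  -- `closure (outside K)` is connected, off `ι(L_w)`, unbounded: inside `outside L_w`
  set E := closure (outsideLeaf F ι y) with hE
  have hEconn : IsPreconnected E := hVc.isPreconnected.closure
  have hEeq : E = outsideLeaf F ι y ∪ ι '' F.leaf y := by rw [hE, closure_eq_self_union_frontier, hfV]
  have hEdisj : Disjoint E (ι '' F.leaf w) := by
    rw [hEeq, disjoint_union_left]
    exact ⟨disjoint_left.2 fun z hz hz' ↦ disjoint_left.1 (disjoint_insideLeaf_outsideLeaf y) (hCw hz') hz, hdisj.symm⟩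
  have hEunb : ¬ IsBounded E := fun h ↦ hVunb (h.subset subset_closure)
  have hEout : E ⊆ outsideLeaf F ι w := by
    rcases hEconn.subset_or_subset hUo' hVo' (disjoint_insideLeaf_outsideLeaf w)
      (fun z hz ↦ mem_insideLeaf_or_mem_outsideLeaf (disjoint_left.1 hEdisj hz)) with h | h
    · exact absurd (hUb'.subset h) hEunb
    · exact h
  -- hence `disc L_w = (outside L_w)ᶜ ⊆ Eᶜ ⊆ inside K`
  intro z hz
  have hz' : z ∉ outsideLeaf F ι w := by rw [← compl_discLeaf]; exact fun h ↦ h hz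
  have hzE : z ∉ E := fun h ↦ hz' (hEout h)
  rw [hEeq, mem_union, not_or] at hzE
  rcases mem_insideLeaf_or_mem_outsideLeaf hzE.2 with h | h
  · exact h
  · exact absurd h hzE.1

/-- **Nesting of discs**: under the same hypotheses the disc of `L_w` is a proper subset of the
disc of `K`. [folklore] -/
theorem discLeaf_ssubset (hbi : IsBiOriented F) (hι : IsOpenEmbedding ι) {y w : X} (hK : IsCompact (F.leaf y))
    (hKw : IsCompact (F.leaf w)) (hw : ι w ∈ discLeaf F ι y) (hwy : w ∉ F.leaf y) :
    discLeaf F ι w ⊂ discLeaf F ι y := by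
  have h := discLeaf_subset_insideLeaf hbi hι hK hKw hw hwy
  refine ⟨h.trans subset_union_right, fun h' ↦ ?_⟩
  exact (h (h' (image_mem_discLeaf (F.mem_leaf_self y)))).1 (mem_image_of_mem ι (F.mem_leaf_self y))

/-- Nesting of discs, with equality allowed. [folklore] -/
theorem discLeaf_subset_discLeaf (hbi : IsBiOriented F) (hι : IsOpenEmbedding ι) {y w : X} (hK : IsCompact (F.leaf y))
    (hKw : IsCompact (F.leaf w)) (hw : ι w ∈ discLeaf F ι y) : discLeaf F ι w ⊆ discLeaf F ι y := by
  by_cases hwy : w ∈ F.leaf y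
  · unfold discLeaf insideLeaf
    rw [leaf_eq_of_mem hwy]
  · exact (discLeaf_ssubset hbi hι hK hKw hw hwy).1

/-- An open leaf inside the disc of `K`, off `K`, lies in the inner domain. [folklore] -/
theorem image_leaf_subset_insideLeaf (hbi : IsBiOriented F) (hι : IsOpenEmbedding ι) {y w : X} (hK : IsCompact (F.leaf y))
    (hw : ι w ∈ discLeaf F ι y) (hwy : w ∉ F.leaf y) : ι '' F.leaf w ⊆ insideLeaf F ι y := by
  intro z hz
  rcases image_leaf_subset_discLeaf hbi hι hK hw hz with h | h
  · obtain ⟨v, hv, rfl⟩ := hz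
    have hv' : v ∈ F.leaf y := (hι.injective.mem_set_image).1 h
    exact absurd (by rw [← leaf_eq_of_mem hv', leaf_eq_of_mem hv]; exact F.mem_leaf_self w) hwy
  · exact h

omit [T2Space X] [SecondCountableTopology X] in
/-- A leaf which is not compact is a noncompact space in its leaf topology (cf.
`noncompactSpace_leaf_of_not_isCompact` of `StabilityBand.lean`). [folklore] -/
theorem noncompactSpace_leaf_of_not_isCompact' {y : X} (h : ¬ IsCompact (F.leaf y)) :
    NoncompactSpace (F.Leaf y) := by
  refine not_compactSpace_iff.1 fun hc ↦ h ?_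
  have heq : F.leaf y = range fun p : F.Leaf y ↦ ofLeafSpace (p : F.LeafSpace) := by
    ext z
    exact ⟨fun hz ↦ ⟨Leaf.mk z hz, rfl⟩, by rintro ⟨p, rfl⟩; exact p.2⟩
  rw [heq]
  exact isCompact_range (Leaf.continuous_coe F y)

/-! ## ω- and α-limit sets of leaves trapped in a compact set -/

section Limits

variable [NoncompactSpace (F.Leaf x)]

/-- The ω-limit set of a leaf inside a closed set lies in it. [folklore] -/
theorem omegaSet_subset_of_forall_mem {D : Set ℂ} (hD : IsClosed D) (h : ∀ q : F.Leaf x, ι (Leaf.pt q) ∈ D) :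
    omegaSet hbi ι x ⊆ D :=
  (iInter_subset _ (Leaf.base F x)).trans (closure_minimal (by rintro _ ⟨q, -, rfl⟩; exact h q) hD)

/-- The α-limit set of a leaf inside a closed set lies in it. [folklore] -/
theorem alphaSet_subset_of_forall_mem {D : Set ℂ} (hD : IsClosed D) (h : ∀ q : F.Leaf x, ι (Leaf.pt q) ∈ D) :
    alphaSet hbi ι x ⊆ D :=
  (iInter_subset _ (Leaf.base F x)).trans (closure_minimal (by rintro _ ⟨q, -, rfl⟩; exact h q) hD)

/-- **The ω-limit set of a leaf inside a compact set is nonempty** (Cantor's intersection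
theorem: the closures of the forward half-leaves are nested nonempty compact sets). [folklore] -/
theorem omegaSet_nonempty_of_forall_mem {D : Set ℂ} (hD : IsCompact D) (h : ∀ q : F.Leaf x, ι (Leaf.pt q) ∈ D) :
    (omegaSet hbi ι x).Nonempty := by
  haveI : Nonempty (F.Leaf x) := ⟨Leaf.base F x⟩
  refine IsCompact.nonempty_iInter_of_directed_nonempty_isCompact_isClosed _ (fun p p' ↦ ?_)
    (fun p ↦ ⟨_, subset_closure ⟨p, mem_fwd_self p, rfl⟩⟩)
    (fun p ↦ hD.of_isClosed_subset isClosed_closure (closure_minimal (by rintro _ ⟨q, -, rfl⟩; exact h q) hD.isClosed))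
    fun p ↦ isClosed_closure
  rcases leafLT_trichotomy (hbi := hbi) p p' with hlt | rfl | hlt
  · exact ⟨p', closure_mono (image_mono (fwd_mono (leafLT_asymm hlt))), subset_rfl⟩
  · exact ⟨p, subset_rfl, subset_rfl⟩
  · exact ⟨p, subset_rfl, closure_mono (image_mono (fwd_mono (leafLT_asymm hlt)))⟩

/-- **The α-limit set of a leaf inside a compact set is nonempty.** [folklore] -/
theorem alphaSet_nonempty_of_forall_mem {D : Set ℂ} (hD : IsCompact D) (h : ∀ q : F.Leaf x, ι (Leaf.pt q) ∈ D) :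
    (alphaSet hbi ι x).Nonempty := by
  rw [alphaSet_eq_omegaSet_flip]
  exact omegaSet_nonempty_of_forall_mem hD fun q ↦ h ((Leaf.toFlip x).symm q)

end Limits

/-! ## Monotonicity of crossings read backwards -/

section Backwards

variable [NoncompactSpace (F.Leaf x)]

omit [T2Space X] [SecondCountableTopology X] [NoncompactSpace (F.Leaf x)] in
/-- Crossings of the flipped box. [folklore] -/
theorem isCrossing_toFlip_iff {p : F.Leaf x} : IsCrossing (flipChart e) (-u₀) (Leaf.toFlip x p) ↔ IsCrossing e u₀ p := by
  show Leaf.pt p ∈ e.source ∧ (flipChart e (Leaf.pt p)).1 = -u₀ ↔ Leaf.pt p ∈ e.source ∧ (e (Leaf.pt p)).1 = u₀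
  rw [flipChart_apply, neg_inj]

omit [T2Space X] [SecondCountableTopology X] [NoncompactSpace (F.Leaf x)] in
/-- Heights in the flipped box. [folklore] -/
theorem ht_toFlip (p : F.Leaf x) : ht (flipChart e) (Leaf.toFlip x p) = ht e p := rfl

/-- **Monotonicity of crossings, read backwards**: if `r < p < q` are crossings of an open leaf
with a vertical, the height of `r` is not strictly between the heights of `p` and `q`
(`ht_not_mem_Ioo` for the flipped foliation). [folklore] -/
theorem ht_not_mem_Ioo_left (he : e ∈ F.atlas) (hι : IsOpenEmbedding ι) {r p q : F.Leaf x}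
    (hrp : leafLT hbi r p) (hpq : leafLT hbi p q) (hr : IsCrossing e u₀ r) (hp : IsCrossing e u₀ p)
    (hq : IsCrossing e u₀ q) : ht e r ∉ Ioo (min (ht e p) (ht e q)) (max (ht e p) (ht e q)) := by
  have h := ht_not_mem_Ioo (hbi := isBiOriented_flip hbi) (u₀ := -u₀) (flipChart_mem_flip he) hι
    ((leafLT_flip_iff q p).2 hpq) ((leafLT_flip_iff p r).2 hrp) (isCrossing_toFlip_iff.2 hq)
    (isCrossing_toFlip_iff.2 hp) (isCrossing_toFlip_iff.2 hr)
  rw [ht_toFlip, ht_toFlip, ht_toFlip, min_comm, max_comm] at h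
  exact h

/-- Crossings before a given one near an α-limit point (the flipped `exists_crossing_near`).
[folklore] -/
theorem exists_crossing_near_alpha (he : e ∈ F.atlas) (hι : IsOpenEmbedding ι) {s : ℝ}
    (hy : ι (e.symm (u₀, s)) ∈ alphaSet hbi ι x) {p₀ : F.Leaf x} (hp₀ : IsCrossing e u₀ p₀) (hne : ht e p₀ ≠ s)
    {ε : ℝ} (hε : 0 < ε) (hε' : ε ≤ |ht e p₀ - s|) :
    ∃ c, leafLT hbi c p₀ ∧ IsCrossing e u₀ c ∧ |ht e c - s| < ε := by
  rw [alphaSet_eq_omegaSet_flip] at hy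
  have hy' : ι ((flipChart e).symm (-u₀, s)) ∈ omegaSet (isBiOriented_flip hbi) ι x := by
    rw [flipChart_symm_apply, neg_neg]; exact hy
  obtain ⟨c', hlt, hc', hnear⟩ := exists_crossing_near (flipChart_mem_flip he) hι hy'
    (isCrossing_toFlip_iff.2 hp₀) hne hε hε'
  refine ⟨(Leaf.toFlip x).symm c', ?_, ?_, hnear⟩
  · rw [← leafLT_flip_iff, (Leaf.toFlip x).apply_symm_apply]; exact hlt
  · rw [← isCrossing_toFlip_iff, (Leaf.toFlip x).apply_symm_apply]; exact hc'

end Backwards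

/-! ## An inner leaf does not accumulate on the boundary leaf at both ends -/

section OneSide

variable {w : X} [NoncompactSpace (F.Leaf w)]

omit [NoncompactSpace (F.Leaf w)] in
/-- **The crossings of an inner open leaf with the vertical through a point `k` of the compact
leaf `K` all lie on one side of `k`.** Two crossings on opposite sides would put the punctured
vertical segment between them in the inner domain (each half is connected and off `K`, which
crosses the vertical only at `k`), and then a whole box around `k` minus the plaque of `k` (its
two halves are swept by plaque segments from those vertical points, off `K`) — but `k` is in the
closure of the outer domain. [folklore] -/
theorem mul_pos_of_isCrossing (hbi : IsBiOriented F) (hι : IsOpenEmbedding ι) {y : X} (hK : IsCompact (F.leaf y))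
    (hin : ι '' F.leaf w ⊆ insideLeaf F ι y) (he : e ∈ F.atlas) {k : X} (hk : k ∈ F.leaf y) (hke : k ∈ e.source)
    {c₁ c₂ : F.Leaf w} (h₁ : IsCrossing e (e k).1 c₁) (h₂ : IsCrossing e (e k).1 c₂) :
    0 < (ht e c₁ - (e k).2) * (ht e c₂ - (e k).2) := by
  haveI : Nontrivial X := nontrivial_of_foliation F w
  set u₀ := (e k).1 with hu₀
  set s := (e k).2 with hs
  have hkeq : e.symm (u₀, s) = k := by rw [show (u₀, s) = e k from rfl, e.left_inv hke]
  have hKk : F.leaf k = F.leaf y := leaf_eq_of_mem hk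
  -- points of the inner leaf are off `K`
  have hoff : ∀ c : F.Leaf w, Leaf.pt c ∉ F.leaf y := fun c hc ↦
    (hin (mem_image_of_mem ι c.2)).1 (mem_image_of_mem ι hc)
  -- heights of crossings differ from `s`
  have hne : ∀ {c : F.Leaf w}, IsCrossing e u₀ c → ht e c ≠ s := fun {c} hc h ↦
    hoff c (by rw [hc.pt_eq, h, hkeq]; exact hk)
  -- `K` meets the vertical only at `k`, and the plaques only at the plaque of `k`
  have hvertK : ∀ {t : ℝ}, e.symm (u₀, t) ∈ F.leaf y → t = s := fun {t} ht' ↦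
    compactLeaf_vert_subsingleton hbi hι hK he ht' (by rw [hkeq]; exact hk)
  have hplaqueK : ∀ {t u : ℝ}, e.symm (u, t) ∈ F.leaf y → t = s := fun {t u} h ↦
    hvertK (F.plaque_subset_leaf_of_mem he h (F.symm_mem_plaque he u t) (F.symm_mem_plaque he u₀ t))
  -- a connected set of points `e⁻¹(q)` off `K` containing an inner point is inner
  have hsweep : ∀ {S : Set (ℝ × ℝ)}, IsPreconnected S → (∀ q ∈ S, e.symm q ∉ F.leaf y) →
      (∃ q ∈ S, ι (e.symm q) ∈ insideLeaf F ι y) → ∀ q ∈ S, ι (e.symm q) ∈ insideLeaf F ι y := by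
    intro S hS hSK ⟨q₀, hq₀, hq₀in⟩ q hq
    have hsub := subset_insideLeaf_of_isPreconnected hbi hι hK
      (hS.image _ (isOpenEmbedding_symm he hι).continuous.continuousOn)
      (disjoint_left.2 (by rintro _ ⟨q', hq', rfl⟩ h; exact hSK q' hq' ((hι.injective.mem_set_image).1 h)))
      ⟨_, mem_image_of_mem _ hq₀, hq₀in⟩
    exact hsub (mem_image_of_mem _ hq)
  -- suppose the crossings are on opposite sides
  by_contra hneg
  have hle : (ht e c₁ - s) * (ht e c₂ - s) ≤ 0 := not_lt.1 hneg
  have hprod_ne : (ht e c₁ - s) * (ht e c₂ - s) ≠ 0 := mul_ne_zero (sub_ne_zero.2 (hne h₁)) (sub_ne_zero.2 (hne h₂))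
  have hlt : (ht e c₁ - s) * (ht e c₂ - s) < 0 := lt_of_le_of_ne hle hprod_ne
  -- name the lower and the upper crossing heights
  obtain ⟨a, b, -, has, hsb, hain, hbin⟩ : ∃ a b : ℝ, a < s ∧ a < s ∧ s < b ∧
      ι (e.symm (u₀, a)) ∈ insideLeaf F ι y ∧ ι (e.symm (u₀, b)) ∈ insideLeaf F ι y := by
    have hc₁in : ι (e.symm (u₀, ht e c₁)) ∈ insideLeaf F ι y := by rw [← h₁.pt_eq]; exact hin (mem_image_of_mem ι c₁.2)
    have hc₂in : ι (e.symm (u₀, ht e c₂)) ∈ insideLeaf F ι y := by rw [← h₂.pt_eq]; exact hin (mem_image_of_mem ι c₂.2)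
    rcases lt_or_gt_of_ne (hne h₁) with hlt₁ | hgt₁
    · have : 0 < ht e c₂ - s := by nlinarith
      exact ⟨ht e c₁, ht e c₂, hlt₁, hlt₁, by linarith, hc₁in, hc₂in⟩
    · have : ht e c₂ - s < 0 := by nlinarith
      exact ⟨ht e c₂, ht e c₁, by linarith, by linarith, hgt₁, hc₂in, hc₁in⟩
  -- the two punctured vertical halves are inner
  have hlow : ∀ t ∈ Ico a s, ι (e.symm (u₀, t)) ∈ insideLeaf F ι y := fun t ht' ↦
    hsweep ((isPreconnected_Ico (a := a) (b := s)).image _ (continuous_const.prodMk continuous_id).continuousOn)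
      (by rintro _ ⟨τ, hτ, rfl⟩ h; exact absurd (hvertK h) (ne_of_lt hτ.2))
      ⟨(u₀, a), ⟨a, ⟨le_rfl, has⟩, rfl⟩, hain⟩ (u₀, t) ⟨t, ht', rfl⟩
  have hhigh : ∀ t ∈ Ioc s b, ι (e.symm (u₀, t)) ∈ insideLeaf F ι y := fun t ht' ↦
    hsweep ((isPreconnected_Ioc (a := s) (b := b)).image _ (continuous_const.prodMk continuous_id).continuousOn)
      (by rintro _ ⟨τ, hτ, rfl⟩ h; exact absurd (hvertK h) (ne_of_gt hτ.1))
      ⟨(u₀, b), ⟨b, ⟨hsb, le_rfl⟩, rfl⟩, hbin⟩ (u₀, t) ⟨t, ht', rfl⟩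
  -- hence the box `ℝ × (a, b)` minus the plaque of `k` is inner (sweep along plaques)
  have hbox : ∀ q : ℝ × ℝ, q.2 ∈ Ioo a b → q.2 ≠ s → ι (e.symm q) ∈ insideLeaf F ι y := by
    rintro ⟨u, t⟩ ht' hts
    have hrow : ∀ u', ι (e.symm (u', t)) ∈ insideLeaf F ι y → ι (e.symm (u, t)) ∈ insideLeaf F ι y := fun u' hu' ↦
      hsweep ((isPreconnected_univ (α := ℝ)).image _ (continuous_id.prodMk continuous_const).continuousOn)
        (by rintro _ ⟨v, -, rfl⟩ h; exact hts (hplaqueK h)) ⟨(u', t), ⟨u', mem_univ _, rfl⟩, hu'⟩ (u, t) ⟨u, mem_univ _, rfl⟩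
    rcases lt_or_gt_of_ne hts with h | h
    · exact hrow u₀ (hlow t ⟨ht'.1.le, h⟩)
    · exact hrow u₀ (hhigh t ⟨h, ht'.2.le⟩)
  -- but `k` is in the closure of the outer domain: an outer point in the open box around `k`
  have hkcl : ι k ∈ closure (outsideLeaf F ι y) := image_mem_closure_outsideLeaf hbi hι hK hk
  set N : Set ℂ := (fun q : ℝ × ℝ ↦ ι (e.symm q)) '' (univ ×ˢ Ioo a b) with hN
  have hNo : IsOpen N := (isOpenEmbedding_symm he hι).isOpenMap _ (isOpen_univ.prod isOpen_Ioo)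
  have hkN : ι k ∈ N := ⟨(u₀, s), ⟨mem_univ _, has, hsb⟩, by show ι (e.symm (u₀, s)) = ι k; rw [hkeq]⟩
  obtain ⟨z, hzN, hzout⟩ := mem_closure_iff.1 hkcl N hNo hkN
  obtain ⟨q, ⟨-, hq⟩, rfl⟩ := hzN
  by_cases hqs : q.2 = s
  · -- on the plaque of `k`: a point of `K`, not outer
    refine hzout.1 (mem_image_of_mem ι ?_)
    have hq' : e.symm q ∈ plaque e s := by rw [show q = (q.1, s) from Prod.ext rfl hqs]; exact F.symm_mem_plaque he q.1 s
    rw [← hKk]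
    exact F.plaque_subset_leaf_of_mem he (F.mem_leaf_self k) (by rw [← hkeq]; exact F.symm_mem_plaque he u₀ s) hq'
  · exact disjoint_left.1 (disjoint_insideLeaf_outsideLeaf y) (hbox q hq hqs) hzout

/-- **An open leaf inside a compact leaf `K` does not both ω- and α-accumulate on `K`.**
Crossings `r < p < q` with the vertical through a point of `K`, with `ht q` strictly between
`ht p` and `ht r` (all on one side of the point, `q` found by ω-accumulation after `p`, `r` by
α-accumulation before `p`), violate the monotonicity of crossings. [folklore] -/
theorem not_mem_omegaSet_of_mem_alphaSet_of_subset (hbi : IsBiOriented F) (hι : IsOpenEmbedding ι) {y : X}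
    (hK : IsCompact (F.leaf y)) (hin : ι '' F.leaf w ⊆ insideLeaf F ι y) {k : X} (hk : k ∈ F.leaf y)
    (hα : ι k ∈ alphaSet hbi ι w) : ι k ∉ omegaSet hbi ι w := by
  intro hω
  obtain ⟨e, he, hke⟩ := F.exists_mem_source k
  set u₀ := (e k).1 with hu₀
  set s := (e k).2 with hs
  have hkeq : e.symm (u₀, s) = k := by rw [show (u₀, s) = e k from rfl, e.left_inv hke]
  rw [← hkeq] at hα hω
  have hoff : ∀ c : F.Leaf w, Leaf.pt c ∉ F.leaf y := fun c hc ↦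
    (hin (mem_image_of_mem ι c.2)).1 (mem_image_of_mem ι hc)
  have hne : ∀ {c : F.Leaf w}, IsCrossing e u₀ c → ht e c ≠ s := fun {c} hc h ↦
    hoff c (by rw [hc.pt_eq, h, hkeq]; exact hk)
  -- a crossing `p`, a later one `q` nearer to `s`, an earlier one `r` nearer still
  obtain ⟨p, hp, -⟩ := exists_crossing_near₀ (hbi := hbi) he hι hω one_pos
  have hdp : 0 < |ht e p - s| := abs_pos.2 (sub_ne_zero.2 (hne hp))
  obtain ⟨q, hpq, hq, hqn⟩ := exists_crossing_near he hι hω hp (hne hp) hdp le_rfl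
  have hdq : 0 < |ht e q - s| := abs_pos.2 (sub_ne_zero.2 (hne hq))
  obtain ⟨r, hrp, hr, hrn⟩ := exists_crossing_near_alpha he hι hα hp (hne hp) hdq (le_of_lt hqn)
  -- all on one side of `s`
  have hspq := mul_pos_of_isCrossing hbi hι hK hin he hk hke hp hq
  have hspr := mul_pos_of_isCrossing hbi hι hK hin he hk hke hp hr
  -- so `ht q` is strictly between `ht p` and `ht r`
  have key := ht_not_mem_Ioo he hι hrp hpq hr hp hq
  apply key
  rcases lt_or_gt_of_ne (hne hp) with hlt | hgt
  · -- all below `s`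
    have hq' : ht e q < s := by nlinarith
    have hr' : ht e r < s := by nlinarith
    rw [abs_of_neg (sub_neg.2 hlt)] at hqn
    rw [abs_of_neg (sub_neg.2 hq')] at hqn hrn
    rw [abs_of_neg (sub_neg.2 hr')] at hrn
    rw [min_eq_right (by linarith), max_eq_left (by linarith)]
    exact ⟨by linarith, by linarith⟩
  · -- all above `s`
    have hq' : s < ht e q := by nlinarith
    have hr' : s < ht e r := by nlinarith
    rw [abs_of_pos (sub_pos.2 hgt)] at hqn
    rw [abs_of_pos (sub_pos.2 hq')] at hqn hrn
    rw [abs_of_pos (sub_pos.2 hr')] at hrn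
    rw [min_eq_left (by linarith), max_eq_right (by linarith)]
    exact ⟨by linarith, by linarith⟩

end OneSide

/-! ## Kneser's theorem -/

/-- **A compact leaf from a trapped point.** If `D₀ ⊆ ι(X)` is compact and saturated (it contains
the image of the leaf of each of its points), every point of `D₀` yields a compact leaf meeting
`D₀`: the leaf itself, or a leaf of an ω-limit point, which is compact because its own ω-limit
set is nonempty and in the domain (`not_mem_omegaSet_of_mem_omegaSet`). [folklore] -/
theorem exists_isCompact_leaf_of_saturated (hbi : IsBiOriented F) (hι : IsOpenEmbedding ι) {D₀ : Set ℂ}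
    (hD₀ : IsCompact D₀) (hX : D₀ ⊆ range ι) (hsat : ∀ w, ι w ∈ D₀ → ι '' F.leaf w ⊆ D₀) {w : X}
    (hw : ι w ∈ D₀) : ∃ y, IsCompact (F.leaf y) ∧ ι y ∈ D₀ := by
  by_cases hcw : IsCompact (F.leaf w)
  · exact ⟨w, hcw, hw⟩
  · haveI := noncompactSpace_leaf_of_not_isCompact' hcw
    have hmem : ∀ q : F.Leaf w, ι (Leaf.pt q) ∈ D₀ := fun q ↦ hsat w hw (mem_image_of_mem ι q.2)
    obtain ⟨z, hz⟩ := omegaSet_nonempty_of_forall_mem (hbi := hbi) hD₀ hmem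
    have hzD : z ∈ D₀ := omegaSet_subset_of_forall_mem hD₀.isClosed hmem hz
    obtain ⟨y₁, rfl⟩ := hX hzD
    refine ⟨y₁, ?_, hzD⟩
    by_contra hcy
    haveI := noncompactSpace_leaf_of_not_isCompact' hcy
    have hmem₁ : ∀ q : F.Leaf y₁, ι (Leaf.pt q) ∈ D₀ := fun q ↦ hsat y₁ hzD (mem_image_of_mem ι q.2)
    obtain ⟨z', hz'⟩ := omegaSet_nonempty_of_forall_mem (hbi := hbi) hD₀ hmem₁
    obtain ⟨y₂, rfl⟩ := hX (omegaSet_subset_of_forall_mem hD₀.isClosed hmem₁ hz')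
    exact not_mem_omegaSet_of_mem_omegaSet hι hz y₂ hz'

/-- **Kneser's theorem for planar foliations: the closed disc bounded by a compact leaf is not
contained in the domain** — a compact leaf encloses a puncture. [folklore] -/
theorem not_discLeaf_subset_range (hbi : IsBiOriented F) (hι : IsOpenEmbedding ι) (hK : IsCompact (F.leaf x)) :
    ¬ discLeaf F ι x ⊆ range ι := by
  intro hX
  -- the family of discs of compact leaves inside the disc of `K`
  set S : Set (Set ℂ) := {D | ∃ y, IsCompact (F.leaf y) ∧ discLeaf F ι y = D ∧ D ⊆ discLeaf F ι x} with hS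
  have hxS : discLeaf F ι x ∈ S := ⟨x, hK, rfl, subset_rfl⟩
  -- chains have lower bounds
  have hchain : ∀ c ⊆ S, IsChain (· ⊆ ·) c → ∃ lb ∈ S, ∀ D ∈ c, lb ⊆ D := by
    intro c hcS hc
    rcases c.eq_empty_or_nonempty with rfl | ⟨D₁, hD₁⟩
    · exact ⟨_, hxS, fun D hD ↦ absurd hD (notMem_empty D)⟩
    haveI : Nonempty c := ⟨⟨D₁, hD₁⟩⟩
    have hcl : ∀ D ∈ c, IsClosed D := fun D hD ↦ by
      obtain ⟨y, hy, rfl, -⟩ := hcS hD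
      exact isClosed_discLeaf hbi hι hy
    have hcpt : ∀ D ∈ c, IsCompact D := fun D hD ↦ by
      obtain ⟨y, hy, rfl, -⟩ := hcS hD
      exact isCompact_discLeaf hbi hι hy
    have hne : ∀ D ∈ c, D.Nonempty := fun D hD ↦ by
      obtain ⟨y, -, rfl, -⟩ := hcS hD
      exact ⟨ι y, image_mem_discLeaf (F.mem_leaf_self y)⟩
    have hdir : DirectedOn (· ⊇ ·) c := fun A hA B hB ↦ by
      rcases hc.total hA hB with h | h
      · exact ⟨A, hA, subset_rfl, h⟩
      · exact ⟨B, hB, h, subset_rfl⟩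
    set D₀ := ⋂₀ c with hD₀
    have hD₀ne : D₀.Nonempty := IsCompact.nonempty_sInter_of_directed_nonempty_isCompact_isClosed hdir hne hcpt hcl
    have hD₀c : IsCompact D₀ := (hcpt D₁ hD₁).of_isClosed_subset (isClosed_sInter hcl) (sInter_subset_of_mem hD₁)
    have hD₀X : D₀ ⊆ range ι := by
      obtain ⟨y', -, hD₁eq, h⟩ := hcS hD₁
      exact ((sInter_subset_of_mem hD₁).trans h).trans hX
    have hsat : ∀ w, ι w ∈ D₀ → ι '' F.leaf w ⊆ D₀ := fun w hw ↦ subset_sInter fun D hD ↦ by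
      obtain ⟨y, hy, rfl, -⟩ := hcS hD
      exact image_leaf_subset_discLeaf hbi hι hy (hw _ hD)
    obtain ⟨z₀, hz₀⟩ := hD₀ne
    obtain ⟨w₀, rfl⟩ := hD₀X hz₀
    obtain ⟨y, hy, hyD₀⟩ := exists_isCompact_leaf_of_saturated hbi hι hD₀c hD₀X hsat hz₀
    have hlb : ∀ D ∈ c, discLeaf F ι y ⊆ D := fun D hD ↦ by
      obtain ⟨y', hy', rfl, -⟩ := hcS hD
      exact discLeaf_subset_discLeaf hbi hι hy' hy (hyD₀ _ hD)
    have hD₁x : D₁ ⊆ discLeaf F ι x := by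
      obtain ⟨y', -, rfl, h⟩ := hcS hD₁
      exact h
    exact ⟨discLeaf F ι y, ⟨y, hy, rfl, (hlb D₁ hD₁).trans hD₁x⟩, hlb⟩
  -- a minimal disc
  obtain ⟨m, ⟨ym, hym, rfl, hmx⟩, hmin⟩ := zorn_superset S hchain
  -- a point inside it and its leaf
  obtain ⟨z, hz⟩ := insideLeaf_nonempty hbi hι hym
  have hzX : z ∈ range ι := hX (hmx (Or.inr hz))
  obtain ⟨w, rfl⟩ := hzX
  have hwy : w ∉ F.leaf ym := fun h ↦ hz.1 (mem_image_of_mem ι h)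
  have hwdisc : ι w ∈ discLeaf F ι ym := Or.inr hz
  -- a smaller disc in `S` contradicts minimality
  have hsmaller : ∀ y, IsCompact (F.leaf y) → ι y ∈ discLeaf F ι ym → y ∉ F.leaf ym → False := by
    intro y hy hyd hyK
    have hss := discLeaf_ssubset hbi hι hym hy hyd hyK
    have hyS : discLeaf F ι y ∈ S := ⟨y, hy, rfl, hss.1.trans hmx⟩
    exact hss.2 (hmin hyS hss.1)
  by_cases hcw : IsCompact (F.leaf w)
  · exact hsmaller w hcw hwdisc hwy
  haveI := noncompactSpace_leaf_of_not_isCompact' hcw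
  have hin : ι '' F.leaf w ⊆ insideLeaf F ι ym := image_leaf_subset_insideLeaf hbi hι hym hwdisc hwy
  have hmc : IsCompact (discLeaf F ι ym) := isCompact_discLeaf hbi hι hym
  have hsat : ∀ v, ι v ∈ discLeaf F ι ym → ι '' F.leaf v ⊆ discLeaf F ι ym := fun v hv ↦
    image_leaf_subset_discLeaf hbi hι hym hv
  have hmemw : ∀ q : F.Leaf w, ι (Leaf.pt q) ∈ discLeaf F ι ym := fun q ↦ hsat w hwdisc (mem_image_of_mem ι q.2)
  -- the ω-limit gives a compact leaf; it must be `K₀`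
  obtain ⟨z₁, hz₁⟩ := omegaSet_nonempty_of_forall_mem (hbi := hbi) hmc hmemw
  have hz₁d : z₁ ∈ discLeaf F ι ym := omegaSet_subset_of_forall_mem hmc.isClosed hmemw hz₁
  obtain ⟨y₁, rfl⟩ := hX (hmx hz₁d)
  have hy₁c : IsCompact (F.leaf y₁) := by
    by_contra hcy
    haveI := noncompactSpace_leaf_of_not_isCompact' hcy
    have hmem₁ : ∀ q : F.Leaf y₁, ι (Leaf.pt q) ∈ discLeaf F ι ym := fun q ↦ hsat y₁ hz₁d (mem_image_of_mem ι q.2)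
    obtain ⟨z', hz'⟩ := omegaSet_nonempty_of_forall_mem (hbi := hbi) hmc hmem₁
    obtain ⟨y₂, rfl⟩ := hX (hmx (omegaSet_subset_of_forall_mem hmc.isClosed hmem₁ hz'))
    exact not_mem_omegaSet_of_mem_omegaSet hι hz₁ y₂ hz'
  have hy₁K : y₁ ∈ F.leaf ym := by by_contra h; exact hsmaller y₁ hy₁c hz₁d h
  -- the α-limit likewise
  obtain ⟨z₂, hz₂⟩ := alphaSet_nonempty_of_forall_mem (hbi := hbi) hmc hmemw
  have hz₂d : z₂ ∈ discLeaf F ι ym := alphaSet_subset_of_forall_mem hmc.isClosed hmemw hz₂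
  obtain ⟨y₂, rfl⟩ := hX (hmx hz₂d)
  have hy₂c : IsCompact (F.leaf y₂) := by
    by_contra hcy
    haveI := noncompactSpace_leaf_of_not_isCompact' hcy
    have hmem₂ : ∀ q : F.Leaf y₂, ι (Leaf.pt q) ∈ discLeaf F ι ym := fun q ↦ hsat y₂ hz₂d (mem_image_of_mem ι q.2)
    obtain ⟨z', hz'⟩ := alphaSet_nonempty_of_forall_mem (hbi := hbi) hmc hmem₂
    obtain ⟨y₃, rfl⟩ := hX (hmx (alphaSet_subset_of_forall_mem hmc.isClosed hmem₂ hz'))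
    exact not_mem_alphaSet_of_mem_alphaSet hι hz₂ y₃ hz'
  have hy₂K : y₂ ∈ F.leaf ym := by by_contra h; exact hsmaller y₂ hy₂c hz₂d h
  -- both limits on `K₀`: impossible
  have hα₁ : ι y₁ ∈ alphaSet hbi ι w :=
    mem_alphaSet_of_mem_leaf hι hz₂ (by rw [leaf_eq_of_mem hy₂K]; exact hy₁K)
  exact not_mem_omegaSet_of_mem_alphaSet_of_subset hbi hι hym hin hy₁K hα₁ hz₁

end Literature.Topology.PlanarFoliations
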